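import Mathlib
import Summits.ValiantsHypothesis.ValiantsHypothesis.Theses.FreeSubtorus
import Literature.Computability.AlgebraicComplexity.LandsbergRessayreProofs
import Literature.Computability.AlgebraicComplexity.OdlyzkoHypercubeSubspace

/-!
# `SubtorusCovering` — birth skeleton (BC3) for crux stmt-ValiantsHypothesis-16134 of
# route-ValiantsHypothesis-FreeSubtorus (rank 3)

Crux, BY NAME: `Summit.ValiantsHypothesis.ValiantsHypothesis.Theses.FreeSubtorus.SubtorusCovering` —
for `n ≥ 3`, every affine determinantal representation `B = Λ₀ + Σ_p x_p B_p` of `per_n` over `ℂ` (size `m`)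
that is equivariant with exact `GL_m × GL_m` lifts (`IsEquivariantDetRepr`) for the subtorus
`T_Λ = closure {diag(d_k e_l) : ∏_k d_k^{Λ_i(inl k)} ∏_l e_l^{Λ_i(inr l)} = 1 (i < r)}` of the row–column torus,
`Λ : Fin r → (Fin n ⊕ Fin n) → ℤ` ADMISSIBLE (every generator has zero row-sum and zero column-sum), satisfies
`C(n, ⌊n/2⌋) ≤ m · 2^r`.

Convention as in the crux: `n` = size of the permanent, `m` = size of the matrix, `r` = number of relations.

## The line: ONE generic element of the subtorus (the route's own proof line, typed; generalises the
## registered line of the `r = 0` ancestor `Cruxes/TorusBound/Lines/birth.lean` from primes to acyclic weights)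

(1) GENERIC ELEMENT (`stub_genericElement`).  Because the generators of `Λ` have zero ROW-sums, the
subtorus `T_Λ` contains an element `t = (d, e) ∈ (ℂˣ)ⁿ × (ℂˣ)ⁿ` (take `d_k = exp a_k`, `e_l = exp a_{n+l}` with
`a = Σ_j θ_j b_j`, `b_j` a rational basis of `Λ^⊥ ⊆ ℚ^{2n}`, `θ_j` rationally independent reals) such that
(i) the `r` defining relations hold at `t` (so `diag(d_k e_l)` is a GENERATOR of `T_Λ`), (iii) a character
`χ ∈ ℤ^{2n}` is `1` at `t` iff `χ` lies in the saturation `Λ_sat` (`N χ ∈ ℤΛ` for some `N ≠ 0`; real `exp` is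
injective and `(Λ^⊥)^⊥ = ℚΛ`), and (ii) NO CLOSED WALK: no non-empty multiset `u` of matrix positions has
`∏_p (d_{p.1} e_{p.2})^{u_p} = 1` (its character has row-sum `|u| > 0`, but everything in `ℚΛ` has row-sum `0`).
(2) GRADED PATH EXPANSION (`stub_pathWeights`, the heart).  By von zur Gathen regularity (`n ≥ 3`, PROVED in the
tree: `vonzurGathen1987_perm_detRepr_rank_holds`) `rank Λ₀ = m - 1`.  Let `(g, h)` be the exact lift of `t`:
`g Λ₀ = Λ₀ h`, `g B_p = c_p B_p h` with `c_p = d_{p.1} e_{p.2}`.  Grade source and target `ℂ^m` by the generalised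
eigenspaces `F_γ` of `h` and `E_β` of `g`; `Λ₀ F_γ ⊆ E_γ`, `B_p F_γ ⊆ E_{c_p γ}`; `ker Λ₀` is an `h`-stable line of
weight `γ₀ ≠ 0`.  In bases adapted to both gradings with `Λ₀` a partial identity off the kernel line `s` and a
cokernel line `t'`, the Leibniz expansion of `det = κ · per_n` (`κ ≠ 0`) runs over a permutation whose non-fixed
part is ONE cycle through `s`: any other cycle would be a closed walk of weights `∏ c = 1`, excluded by (ii).  So
every `σ ∈ S_n` (coefficient of `x_σ` is `κ ≠ 0`) is spelled by an `s → t'` path whose `i`-th vertex is a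
generalised eigenvector of `g` of weight `γ₀ ∏_{k ∈ I} c_{(k, σ k)}` for an `i`-set `I` of rows: every `σ` is
SERVED at every level `1 ≤ i ≤ n`.
(3) COVERING COUNT AT THE MIDDLE LEVEL (`stub_levelCount`).  At level `i = ⌊n/2⌋`: distinct served weights are
distinct eigenvalues of `g`, whose generalised eigenspaces are independent, so there are `≤ m` of them; two pairs
`(I, J)`, `(I', J')` with the same weight have `d^{1_I - 1_{I'}} e^{1_J - 1_{J'}} = 1`, so by (iii) their indicator
vectors differ by an element of `ℚΛ` — one weight class of pairs lies in ONE translate of the `≤ r`-dimensional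
subspace `ℚΛ` and holds `≤ 2^r` hypercube points (Odlyzko's lemma, vendored statement
`odlyzko_ncard_hypercube_inter_translate_le`, Odlyzko 1988 p. 127); a pair `(I, J)` serves the `i!(n-i)!`
permutations with `σ(I) = J`; every `σ` is served.  Hence `n! ≤ m · 2^r · i!(n-i)!`, i.e. `C(n, ⌊n/2⌋) ≤ m · 2^r`.

## Stubs (registered; the ONLY `sorry`s of this file) and composition

* `stub_genericElement` (size M — "a generic point of an admissibly cut subtorus separates characters modulo
  `Λ_sat` and has no closed weight walk"): ℚ-linear algebra (`(Λ^⊥)^⊥ = span_ℚ Λ` in `ℚ^{2n}`), rationally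
  independent reals, injectivity of real `exp` / `Complex.exp` on `ℝ`; only the ROW half of admissibility is a
  hypothesis (the stub is stated with what it needs).  Stated over `ℂˣ`-valued `d, e` and `zpow`, literally the
  membership predicate of the crux's generator set.
* `stub_pathWeights` (size L, the heart — "graded normal form + Hamiltonian-path expansion for an arbitrary
  ACYCLIC weight `c : Fin n × Fin n → ℂ`"): for a REGULAR representation and an exact lift `(g, h)` with
  `g Λ₀ = Λ₀ h`, `g B_p = c_p B_p h`, `ker Λ₀ ≤ F_{γ₀}(h)`: every `σ` is served at every level `1 ≤ i ≤ n` by a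
  non-zero generalised eigenspace of `g` at `γ₀ ∏_{k∈I} c (k, σ k)`, `|I| = i`.  It is `TorusBound`'s registered
  `stub_pathWeights` (stmt-4164/5114) with the `2n` primes replaced by any weights without closed walks — one proof
  serves both lines (primes `> 1` have no closed walk).  Leans on: `LRTorusWeights` / `GenericTorusGrading`
  (`map_maxGenEigenspace_le_of_comp_eq_smul`, eigenspace toolkit), `Matrix.det_apply` (Leibniz), `coeff` of `perPoly`
  (`StandardFamilies`), `LRPencilOfMatrix.map_eval_eq`.
* `stub_levelCount` (size M — "Odlyzko covering count"): `γ₀ ≠ 0`, exact separation (iii), every `σ` served at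
  level `⌊n/2⌋` by `toLin' g` (`g : Matrix (Fin m) (Fin m) ℂ` arbitrary) ⇒ `C(n, ⌊n/2⌋) ≤ m · 2^r`.  Leans on:
  `Module.End.independent_maxGenEigenspace`, `iSupIndep.subtype_ne_bot_le_finrank`, the Odlyzko statement
  `odlyzko_ncard_hypercube_inter_translate_le` (a `def … : Prop` named fact — its elementary pivot-coordinate proof
  is part of this stub's work, over `K = ℚ`, transported along `finSumFinEquiv`), `Nat.choose_mul_factorial_mul_factorial`,
  `Fintype.card_perm`, counting `{σ : σ(I) = J}`.
* COMPOSITION `SubtorusCovering_of : Stmt.stub_genericElement → Stmt.stub_pathWeights → Stmt.stub_levelCount →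
  SubtorusCovering` (kernel-checked, NO sorry; mirrors `Cruxes/TorusBound/Lines/birth.lean` §3): von zur Gathen
  regularity (tree theorem); the generic `(d, e)` of stub 1 from the ROW half of admissibility; the torus element
  `diagUnit (d_k e_l)` is a generator of `T_Λ` by (i) (`Subgroup.subset_closure`); its exact lift from
  `IsEquivariantDetRepr.exists_lift_stabilising`, read on coefficient matrices (`coeffMat_linSubstEntries`,
  `sum_diagonal_smul`, `coeffMat_C_mul_mul_C`, `mul_eq_of_eq_mul_mul_inv`); `dim ker Λ₀ = 1` from `rank Λ₀ = m - 1`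
  (`m ≥ 1` because `per_n(0) = 0 ≠ 1 = det ∅`); the eigenvalue `γ₀ ≠ 0` of `h` on the kernel line
  (`LRPencil.exists_eigenvalue_of_finrank_ker_eq_one` via `liftOfMatrices … |>.map_ker_eq`); stub 2 with the
  weights `c_p = d_{p.1} e_{p.2}` and the no-closed-walk property (ii); stub 3 at level `⌊n/2⌋` (`1 ≤ ⌊n/2⌋ ≤ n`
  from `n ≥ 3`) with the separation property (iii).  `SubtorusCovering_proof : SubtorusCovering :=
  SubtorusCovering_of stub_genericElement stub_pathWeights stub_levelCount`.

## Shape (skeleton audit by-name rule, as in `Cruxes/TorusBound/Lines/birth.lean`)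
* `Stmt.stub_…` — the three stub statements as precise `Prop`s, named like the stubs;
* `stub_…` — the same statements as sorried theorems (the REGISTERED stubs; `sorry` occurs nowhere else);
* `SubtorusCovering_of` — the composition, real proof; `SubtorusCovering_proof` — the crux by name from the stubs.
Each stub can land as `Theorems/FreeSubtorusSubtorusCovering<Stub>.lean` `--supports stmt-ValiantsHypothesis-16134`.

## BC3 probes (registrar's folder `bc/SubtorusCovering_probes_crux.lean`, `bc/SubtorusCovering_probes_summit.lean`)
For each stub `S ∈ {Stmt.stub_genericElement, Stmt.stub_pathWeights, Stmt.stub_levelCount}` and each target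
`T ∈ {FreeSubtorus.SubtorusCovering, ValiantsHypothesis}`: `example : S → T := by first | exact? | simpa | simpa [S] |
(unfold S; simpa) | aesop` (maxHeartbeats 400000; imports = the route thesis file + `LandsbergRessayreProofs`, the stub
statements restated verbatim, this file NOT imported) — ALL SIX FAIL (2026-08-17): crux target rc 1, wall 141 s,
`unsolved goals a : Stmt.stub_genericElement ⊢ Theses.FreeSubtorus.SubtorusCovering` (likewise `stub_pathWeights`,
`stub_levelCount`), each with `aesop: failed to prove the goal after exhaustive search`; summit target rc 1, wall 104 s,
`unsolved goals a : Stmt.stub_… ⊢ ValiantsHypothesis` (3×), aesop exhaustive-search failure (3×); no timeouts.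
No stub is comparable to the crux or the summit by a cheap implication: stub 1 is a statement about characters of a
subtorus (no matrices of polynomials at all), stub 2 concludes weight occurrences for ONE lifted element under
regularity (no size bound), stub 3 is a counting statement about an arbitrary endomorphism of `ℂ^m`.

**Disproof used.** None exists: `Cruxes/SubtorusCovering/` had no workfiles (no `Disproof.lean`, no `Negative/` lemma,
no ideas, no dead lines) at registration (2026-08-17); `ledger negatives --problem ValiantsHypothesis` (4 entries:
UlrichPadded NoTightInfinity stmt-5668, Elusive candidate stmt-0340, GrenetRigidity optimal-uniqueness stmt-3735/3738) has
nothing on (sub)torus-equivariant representations — uniqueness / finiteness of optimal representations (refuted) is NOT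
used by this line.  Refuter review R1 (item evidence, 2026-08-16): the crux survives and is probably true in the stronger
form `(2^n - 2)/2^r ≤ m - 1`; the stubs are cut so that the stronger form is the same three stubs with stub 3 summed over
all levels.  Hardest stub: `stub_pathWeights`.
-/

namespace Summit.ValiantsHypothesis.ValiantsHypothesis.Cruxes.SubtorusCovering.Birth

open Matrix MvPolynomial Finset
open Literature.Computability.AlgebraicComplexity LRPencil
open scoped Kronecker

-- `Summit.ValiantsHypothesis.ValiantsHypothesis.…` is the tree's mandated single-conjunct layout (Sub = Summit).
set_option linter.dupNamespace false

noncomputable section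

/-! ## §1 The three stub statements as `Prop`s (named like the registered stubs) -/

/-- Statement of stub 1 (`stub_genericElement`) — **a generic element of an admissibly cut subtorus.**
If every generator `Λ_i` has zero row-sum, there are `d e : Fin n → ℂˣ` with (i) all `r` relations
`∏_k d_k^{Λ_i(inl k)} · ∏_l e_l^{Λ_i(inr l)} = 1` (so `diag(d_k e_l)` is a generator of `T_Λ`), (ii) no closed
weight walk `∏_p (d_{p.1} e_{p.2})^{u_p} = 1`, `u ≠ 0`, and (iii) exact separation: a character `χ` of the
row–column torus is `1` at `(d, e)` only if `χ ∈ Λ_sat` (`N • χ ∈ ℤΛ`, `N ≠ 0`).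
[cite: LandsbergRessayre2017, §6] [cite: Odlyzko1988, p. 127] -/
def Stmt.stub_genericElement : Prop :=
  ∀ (n r : ℕ) (Λ : Fin r → (Fin n ⊕ Fin n) → ℤ),
    (∀ i, (∑ k, Λ i (Sum.inl k)) = 0) →
    ∃ d e : Fin n → ℂˣ,
      (∀ i, (∏ k, (d k) ^ (Λ i (Sum.inl k))) * (∏ l, (e l) ^ (Λ i (Sum.inr l))) = 1) ∧
      (∀ u : Fin n × Fin n → ℕ, u ≠ 0 → (∏ p, ((d p.1 : ℂ) * (e p.2 : ℂ)) ^ (u p)) ≠ 1) ∧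
      (∀ χ : (Fin n ⊕ Fin n) → ℤ,
        (∏ k, (d k) ^ (χ (Sum.inl k))) * (∏ l, (e l) ^ (χ (Sum.inr l))) = 1 →
        ∃ (N : ℤ) (a : Fin r → ℤ), N ≠ 0 ∧ N • χ = ∑ i, a i • Λ i)

/-- Statement of stub 2 (`stub_pathWeights`) — **every permutation is served at every level by a weight
of `g`**, for an arbitrary weight `c : Fin n × Fin n → ℂ` WITHOUT CLOSED WALKS.  For a REGULAR affine
determinantal representation `A` of `per_n` (size `m`) and an exact lift `(g, h)` of the torus element
`x_p ↦ c_p x_p` on the constant and linear parts (`g Λ₀ = Λ₀ h`, `g A_p = c_p A_p h`), with `ker Λ₀` inside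
the generalised `γ₀`-eigenspace of `h`: for every `σ ∈ S_n` and `1 ≤ i ≤ n` some `i`-subset `I` of rows has
`maxGenEigenspace (toLin' g) (γ₀ ∏_{k∈I} c (k, σ k)) ≠ ⊥`.  (Acyclic matched digraph ⇒ `det` = signed sum of
`s → t'` paths; the path spelling `x_σ` visits these weights.)  Specialises to `TorusBound`'s registered
`stub_pathWeights` (`c (k, j) = p_k q_j`, primes). [cite: LandsbergRessayre2017, §6] [cite: Grenet2011] -/
def Stmt.stub_pathWeights : Prop :=
  ∀ (n m : ℕ) (A : Matrix (Fin m) (Fin m) (MvPolynomial (Fin n × Fin n) ℂ)) (c : Fin n × Fin n → ℂ)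
    (g h : GL (Fin m) ℂ) (γ₀ : ℂ),
    (∀ p, c p ≠ 0) →
    (∀ u : Fin n × Fin n → ℕ, u ≠ 0 → (∏ p, (c p) ^ (u p)) ≠ 1) →
    IsRegularDetRepr (perPoly (Fin n) ℂ) A →
    (g : Matrix (Fin m) (Fin m) ℂ) * constPart A = constPart A * (h : Matrix (Fin m) (Fin m) ℂ) →
    (∀ p : Fin n × Fin n, (g : Matrix (Fin m) (Fin m) ℂ) * coeffMat A p =
        c p • (coeffMat A p * (h : Matrix (Fin m) (Fin m) ℂ))) →
    LinearMap.ker (Matrix.toLin' (constPart A)) ≤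
      Module.End.maxGenEigenspace (Matrix.toLin' (h : Matrix (Fin m) (Fin m) ℂ)) γ₀ →
    ∀ (σ : Equiv.Perm (Fin n)) (i : ℕ), 1 ≤ i → i ≤ n →
      ∃ I : Finset (Fin n), I.card = i ∧
        Module.End.maxGenEigenspace (Matrix.toLin' (g : Matrix (Fin m) (Fin m) ℂ))
          (γ₀ * ∏ k ∈ I, c (k, σ k)) ≠ ⊥

/-- Statement of stub 3 (`stub_levelCount`) — **the Odlyzko covering count at the middle level.**  If
`γ₀ ≠ 0`, `(d, e)` separates characters exactly modulo `Λ_sat` (`r` generators) and an endomorphism `toLin' g`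
of `ℂ^m` has, for every `σ ∈ S_n`, a non-zero generalised eigenspace at `γ₀ ∏_{k∈I} d_k e_{σ k}` for some
`⌊n/2⌋`-set `I`, then `C(n, ⌊n/2⌋) ≤ m · 2^r`: served weights are `≤ m` (independent eigenspaces), a weight class
of pairs `(I, σ I)` is a set of hypercube points in one translate of `ℚΛ` (`≤ 2^r`, Odlyzko), and a pair serves
`⌊n/2⌋! (n - ⌊n/2⌋)!` permutations. [cite: Odlyzko1988, p. 127] [cite: LandsbergRessayre2017, §6] -/
def Stmt.stub_levelCount : Prop :=
  ∀ (n m r : ℕ) (Λ : Fin r → (Fin n ⊕ Fin n) → ℤ) (d e : Fin n → ℂˣ) (γ₀ : ℂ)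
    (g : Matrix (Fin m) (Fin m) ℂ),
    γ₀ ≠ 0 →
    (∀ χ : (Fin n ⊕ Fin n) → ℤ,
      (∏ k, (d k) ^ (χ (Sum.inl k))) * (∏ l, (e l) ^ (χ (Sum.inr l))) = 1 →
      ∃ (N : ℤ) (a : Fin r → ℤ), N ≠ 0 ∧ N • χ = ∑ i, a i • Λ i) →
    (∀ σ : Equiv.Perm (Fin n), ∃ I : Finset (Fin n), I.card = n / 2 ∧
      Module.End.maxGenEigenspace (Matrix.toLin' g)
        (γ₀ * ∏ k ∈ I, ((d k : ℂ) * (e (σ k) : ℂ))) ≠ ⊥) →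
    n.choose (n / 2) ≤ m * 2 ^ r

/-! ## §2 Registered stubs (the ONLY sorries of this file) -/

/-- **Registered stub 1 = `Stmt.stub_genericElement`** (a generic element of the admissibly cut subtorus:
relations hold, no closed weight walk, exact separation of characters modulo `Λ_sat`).  Size M.
[cite: LandsbergRessayre2017, §6] -/
theorem stub_genericElement :
    ∀ (n r : ℕ) (Λ : Fin r → (Fin n ⊕ Fin n) → ℤ),
    (∀ i, (∑ k, Λ i (Sum.inl k)) = 0) →
    ∃ d e : Fin n → ℂˣ,
      (∀ i, (∏ k, (d k) ^ (Λ i (Sum.inl k))) * (∏ l, (e l) ^ (Λ i (Sum.inr l))) = 1) ∧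
      (∀ u : Fin n × Fin n → ℕ, u ≠ 0 → (∏ p, ((d p.1 : ℂ) * (e p.2 : ℂ)) ^ (u p)) ≠ 1) ∧
      (∀ χ : (Fin n ⊕ Fin n) → ℤ,
        (∏ k, (d k) ^ (χ (Sum.inl k))) * (∏ l, (e l) ^ (χ (Sum.inr l))) = 1 →
        ∃ (N : ℤ) (a : Fin r → ℤ), N ≠ 0 ∧ N • χ = ∑ i, a i • Λ i) := by
  sorry

/-- **Registered stub 2 = `Stmt.stub_pathWeights`** (graded normal form + Hamiltonian-path expansion for an
acyclic weight: every `σ ∈ S_n` is served at every level `1 ≤ i ≤ n` by a weight `γ₀ ∏_{k∈I} c (k, σ k)`,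
`|I| = i`, of the target-side lift `g`).  Size L; the hardest stub. [cite: LandsbergRessayre2017, §6] -/
theorem stub_pathWeights :
    ∀ (n m : ℕ) (A : Matrix (Fin m) (Fin m) (MvPolynomial (Fin n × Fin n) ℂ)) (c : Fin n × Fin n → ℂ)
    (g h : GL (Fin m) ℂ) (γ₀ : ℂ),
    (∀ p, c p ≠ 0) →
    (∀ u : Fin n × Fin n → ℕ, u ≠ 0 → (∏ p, (c p) ^ (u p)) ≠ 1) →
    IsRegularDetRepr (perPoly (Fin n) ℂ) A →
    (g : Matrix (Fin m) (Fin m) ℂ) * constPart A = constPart A * (h : Matrix (Fin m) (Fin m) ℂ) →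
    (∀ p : Fin n × Fin n, (g : Matrix (Fin m) (Fin m) ℂ) * coeffMat A p =
        c p • (coeffMat A p * (h : Matrix (Fin m) (Fin m) ℂ))) →
    LinearMap.ker (Matrix.toLin' (constPart A)) ≤
      Module.End.maxGenEigenspace (Matrix.toLin' (h : Matrix (Fin m) (Fin m) ℂ)) γ₀ →
    ∀ (σ : Equiv.Perm (Fin n)) (i : ℕ), 1 ≤ i → i ≤ n →
      ∃ I : Finset (Fin n), I.card = i ∧
        Module.End.maxGenEigenspace (Matrix.toLin' (g : Matrix (Fin m) (Fin m) ℂ))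
          (γ₀ * ∏ k ∈ I, c (k, σ k)) ≠ ⊥ := by
  sorry

/-- **Registered stub 3 = `Stmt.stub_levelCount`** (Odlyzko covering count at the middle level: independent
generalised eigenspaces, `≤ 2^r` hypercube points per translate of `ℚΛ`, `⌊n/2⌋!(n-⌊n/2⌋)!` permutations per
pair).  Size M. [cite: Odlyzko1988, p. 127] -/
theorem stub_levelCount :
    ∀ (n m r : ℕ) (Λ : Fin r → (Fin n ⊕ Fin n) → ℤ) (d e : Fin n → ℂˣ) (γ₀ : ℂ)
    (g : Matrix (Fin m) (Fin m) ℂ),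
    γ₀ ≠ 0 →
    (∀ χ : (Fin n ⊕ Fin n) → ℤ,
      (∏ k, (d k) ^ (χ (Sum.inl k))) * (∏ l, (e l) ^ (χ (Sum.inr l))) = 1 →
      ∃ (N : ℤ) (a : Fin r → ℤ), N ≠ 0 ∧ N • χ = ∑ i, a i • Λ i) →
    (∀ σ : Equiv.Perm (Fin n), ∃ I : Finset (Fin n), I.card = n / 2 ∧
      Module.End.maxGenEigenspace (Matrix.toLin' g)
        (γ₀ * ∏ k ∈ I, ((d k : ℂ) * (e (σ k) : ℂ))) ≠ ⊥) →
    n.choose (n / 2) ≤ m * 2 ^ r := by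
  sorry

/-! ## §3 The composition (kernel-checked, sorry-free) -/

/-- Summing a family against a row of a diagonal matrix picks out the diagonal entry
(the substitution `x_v ↦ c_v x_v` on coefficient matrices). [folklore] -/
theorem sum_diagonal_smul {ι M : Type*} [Fintype ι] [DecidableEq ι] [AddCommMonoid M] [Module ℂ M]
    (c : ι → ℂ) (B : ι → M) (v : ι) :
    ∑ i, (Matrix.diagonal c) v i • B i = c v • B v := by
  rw [Finset.sum_eq_single v]
  · rw [Matrix.diagonal_apply_eq]
  · intro i _ hi
    rw [Matrix.diagonal_apply_ne _ (Ne.symm hi), zero_smul]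
  · intro hv
    exact absurd (Finset.mem_univ v) hv

/-- **The crux from the three stubs** (real proof).  Given an admissible `Λ` and a `T_Λ`-equivariant affine
determinantal representation `B` of `per_n`, `n ≥ 3`, of size `m`:
(0) `B` is regular (von zur Gathen 1987 Thm 3.1 = LR17 Lemma 3.2, a tree theorem);
(1) stub 1 gives a generic `(d, e)`: relations (i), no closed walk (ii), exact separation (iii) — only the row
half of admissibility is consumed;
(2) by (i) the torus element `x_{kl} ↦ d_k e_l x_{kl}`, i.e. `diag(d_k e_l) ∈ GL(n²)`, is a generator of `T_Λ`;
(3) its exact lift `(g, h)` satisfies `g Λ₀ = Λ₀ h` and, reading coefficient matrices on both sides of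
`B(t·x) = g B(x) h⁻¹`, `g B_p = d_{p.1} e_{p.2} B_p h`;
(4) `rank Λ₀ = m - 1` makes `ker Λ₀` an `h`-stable line (`m ≥ 1` as `per_n(0) = 0 ≠ det` of the empty matrix),
on which `h` has an eigenvalue `γ₀ ≠ 0`;
(5) stub 2 (weights `c_p = d_{p.1} e_{p.2}`, acyclic by (ii)) serves every `σ` at every level, in particular
at level `⌊n/2⌋` (`1 ≤ ⌊n/2⌋ ≤ n`); (6) stub 3 counts with (iii): `C(n, ⌊n/2⌋) ≤ m · 2^r`.
[cite: LandsbergRessayre2017, Thm. 2.8, §6] [cite: Vonzurgathen1987, Thm. 3.1] [cite: Odlyzko1988, p. 127] -/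
theorem SubtorusCovering_of :
    Stmt.stub_genericElement → Stmt.stub_pathWeights → Stmt.stub_levelCount →
      Summit.ValiantsHypothesis.ValiantsHypothesis.Theses.FreeSubtorus.SubtorusCovering := by
  intro hGE hPW hLC
  unfold Stmt.stub_genericElement at hGE
  unfold Stmt.stub_pathWeights at hPW
  unfold Stmt.stub_levelCount at hLC
  intro n hn m r Λ B hΛ hB
  classical
  -- (0) the affine data and regularity (von zur Gathen 1987, Thm. 3.1, proved in the tree)
  have haff : ∀ i j, (B i j).totalDegree ≤ 1 := hB.1.1
  have hdet : B.det = perPoly (Fin n) ℂ := hB.1.2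
  have hreg : IsRegularDetRepr (perPoly (Fin n) ℂ) B :=
    hB.isRegular_perPoly vonzurGathen1987_perm_detRepr_rank_holds hn
  -- (1) a generic element `(d, e)` of the subtorus (stub 1; only the ROW half of admissibility is used)
  obtain ⟨d, e, hrel, hnocyc, hsep⟩ := hGE n r Λ (fun i => (hΛ i).1)
  have hc0 : ∀ p : Fin n × Fin n, ((fun p : Fin n × Fin n => (d p.1 : ℂ) * (e p.2 : ℂ)) p) ≠ 0 :=
    fun p => mul_ne_zero (d p.1).ne_zero (e p.2).ne_zero
  have hd0 : ∀ k, ((fun k => (d k : ℂ)) k) ≠ 0 := fun k => (d k).ne_zero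
  have he0 : ∀ l, ((fun l => (e l : ℂ)) l) ≠ 0 := fun l => (e l).ne_zero
  -- (2) the torus element `x_{kl} ↦ d_k e_l x_{kl}` = `diag(d) ⊗ diag(e) ∈ GL(n²)`; it is a generator of `T_Λ`
  let γ : GL (Fin n × Fin n) ℂ :=
    Matrix.GeneralLinearGroup.kronecker (diagUnit ℂ (fun k => (d k : ℂ)) hd0) (diagUnit ℂ (fun l => (e l : ℂ)) he0)
  have hγcoe : (γ : Matrix (Fin n × Fin n) (Fin n × Fin n) ℂ) =
      Matrix.diagonal (fun p : Fin n × Fin n => (d p.1 : ℂ) * (e p.2 : ℂ)) := by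
    show Matrix.diagonal _ ⊗ₖ Matrix.diagonal _ = _
    exact Matrix.diagonal_kronecker_diagonal _ _
  have hγmem : γ ∈ Subgroup.closure {γ : Matrix.GeneralLinearGroup (Fin n × Fin n) ℂ |
      ∃ d e : Fin n → ℂˣ, (∀ i, (∏ k, (d k) ^ (Λ i (Sum.inl k))) * (∏ l, (e l) ^ (Λ i (Sum.inr l))) = 1) ∧
        (γ : Matrix (Fin n × Fin n) (Fin n × Fin n) ℂ) =
          Matrix.diagonal (fun p => (d p.1 : ℂ) * (e p.2 : ℂ))} :=
    Subgroup.subset_closure ⟨d, e, hrel, hγcoe⟩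
  -- (3) its exact lift `(g, h)`: `g Λ₀ = Λ₀ h` and `g B_p = d_{p.1} e_{p.2} B_p h`
  obtain ⟨g, h, hgh, hΛ0⟩ := hB.exists_lift_stabilising hγmem
  have hAv : ∀ p : Fin n × Fin n, (g : Matrix (Fin m) (Fin m) ℂ) * coeffMat B p =
      ((d p.1 : ℂ) * (e p.2 : ℂ)) • (coeffMat B p * (h : Matrix (Fin m) (Fin m) ℂ)) := by
    intro p
    have e1 : coeffMat (Matrix.linSubstEntries γ B) p =
        coeffMat ((g : Matrix (Fin m) (Fin m) ℂ).map C * B *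
          ((h⁻¹ : GL (Fin m) ℂ) : Matrix (Fin m) (Fin m) ℂ).map C) p := by rw [hgh]
    rw [coeffMat_linSubstEntries _ _ haff, hγcoe, sum_diagonal_smul, coeffMat_C_mul_mul_C] at e1
    rw [mul_eq_of_eq_mul_mul_inv e1, Matrix.smul_mul]
  -- (4) regularity: the kernel of `Λ₀` is a line, on which `h` has an eigenvalue `γ₀ ≠ 0`
  set Λm : Matrix (Fin m) (Fin m) ℂ := constPart B with hΛm
  have hK : Module.finrank ℂ (LinearMap.ker (Matrix.toLin' Λm)) = 1 := by
    have h1 := LinearMap.finrank_range_add_finrank_ker (Matrix.toLin' Λm)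
    rw [Module.finrank_fin_fun] at h1
    have h2 : Module.finrank ℂ (LinearMap.range (Matrix.toLin' Λm)) = m - 1 := by
      rw [Matrix.toLin'_apply']; exact hreg.2
    have hm : 1 ≤ m := by
      rcases Nat.eq_zero_or_pos m with h0 | h0
      · subst h0
        exfalso
        have h3 : B.det = 1 := Matrix.det_isEmpty
        have h4 := congrArg constantCoeff hdet
        rw [h3, constantCoeff_perPoly ℂ (by omega : 1 ≤ n), map_one] at h4
        exact one_ne_zero h4
      · exact h0
    omega
  let L : Lift (Matrix.toLin' Λm) (fun _ _ : Fin n => Matrix.toLin' (0 : Matrix (Fin m) (Fin m) ℂ)) 1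
      (fun _ => (1 : ℂ)) :=
    liftOfMatrices Λm (fun _ _ => 0) 1 _ (fun _ => one_ne_zero) g h hΛ0 (fun _ _ => by simp)
  obtain ⟨γ₀, hγ₀, hker⟩ := exists_eigenvalue_of_finrank_ker_eq_one _ L.C L.map_ker_eq hK
  have hker' : LinearMap.ker (Matrix.toLin' (constPart B)) ≤
      Module.End.maxGenEigenspace (Matrix.toLin' (h : Matrix (Fin m) (Fin m) ℂ)) γ₀ := hker
  -- (5) stub 2: every permutation is served at every level by a weight of `g` (acyclic weights by (ii))
  have hserved := hPW n m B (fun p : Fin n × Fin n => (d p.1 : ℂ) * (e p.2 : ℂ)) g h γ₀ hc0 hnocyc hreg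
    hΛ0 hAv hker'
  -- (6) stub 3 at the middle level `⌊n/2⌋`, with the exact separation (iii)
  refine hLC n m r Λ d e γ₀ (g : Matrix (Fin m) (Fin m) ℂ) hγ₀ hsep fun σ => ?_
  obtain ⟨I, hI, hne⟩ := hserved σ (n / 2) (by omega) (Nat.div_le_self n 2)
  exact ⟨I, hI, hne⟩

/-- **THE SKELETON: the crux BY NAME, modulo exactly the three registered stubs** (the compiler checks
that the `Stmt` copies and the stub statements agree). [cite: LandsbergRessayre2017, Thm. 2.8] -/
theorem SubtorusCovering_proof :
    Summit.ValiantsHypothesis.ValiantsHypothesis.Theses.FreeSubtorus.SubtorusCovering :=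
  SubtorusCovering_of stub_genericElement stub_pathWeights stub_levelCount

end

end Summit.ValiantsHypothesis.ValiantsHypothesis.Cruxes.SubtorusCovering.Birth
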